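import Mathlib.MeasureTheory.Covering.DensityTheorem
import Mathlib.MeasureTheory.Measure.Lebesgue.VolumeOfBalls
import Literature.Probability.Percolation.TwoArmScalingLimitFromLoops
import Literature.Probability.RandomPlanarGeometry.BallMoebius
import Literature.Probability.RandomPlanarGeometry.LoopSpaceRangeEvents
import HarnessLib

/-!
# No touching in the Camia–Newman limit by Möbius averaging

Topic: Probability / Percolation. The named fact `SmirnovWerner2001_twoArm_scalingLimit`
(S. Smirnov, W. Werner, Math. Res. Lett. **8** (2001), §4, (16) with (9), `j = 2`) was derived in
`TwoArmScalingLimitFromLoops.lean` from (a) the convergence in law of the critical-percolation loop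
collections (the Camia–Newman fact `exists_isCNLFamily_tendsto`), (b) a **no-touching** property of
the limit law at the hexagonal annuli (the near-miss event "every `ε`-near crossing of `r ≤ N ≤ R`
exists but no member crosses strictly" is null) and (c) the exponent `-1/4` of the continuum crossing
probabilities. Here hypothesis (b) is PROVED for disc domains from the axioms of a
Continuum-Nonsimple-Loop family alone (`IsCNLFamily`: conformal invariance and a.s. finiteness of
the number of traces of diameter `> ε`), by averaging over the Möbius automorphisms of the disc — the
"conformal invariance forbids atoms" argument:

* the law `ν D` of the limit in the disc `D` of radius `ρ` is invariant under the push-forward along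
  every Möbius automorphism `Φ_θ` of `D` (`IsCNLFamily.measure_preimage_map_ballMoebiusExt`), in
  particular along the two-parameter affine family `θ ↦ shearSL θ` of `BallMoebius.lean`;
* the near-miss event read through `Φ_θ` is the near-miss event of the distorted gauge `N ∘ Φ_θ`,
  and `(θ, L) ↦ [L near-misses for N ∘ Φ_θ]` is a Borel set of `ℂ × LoopSpace ℂ`
  (`LoopSpaceRangeEvents.lean`), so by the averaging lemma (Tonelli) it suffices that for `ν D`-a.e.
  `L` the set of parameters `θ` at which `L` near-misses is Lebesgue-null;
* for a collection with finitely many traces of diameter `> ε` this parameter set lies in finitely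
  many level sets `{θ | min_s N ∘ Φ_θ = r}`, `{θ | max_s N ∘ Φ_θ = R}` of compact traces `s`
  (`setOf_nearMiss_param_subset`);
* **such level sets are Lebesgue-null** (`volume_levelSet_min_eq_zero`,
  `volume_levelSet_max_eq_zero`): at a parameter `θ₀` of the level set, moving the extremal image
  point radially by the explicit first-order calculus of the Cayley transform along the shear family
  (`exists_balls_moving_radially`, based on the exact increment `C(η') - C(η) = 2i(η' - η)/((η' + i)(η + i))`)
  exhibits, at every small scale, a ball of comparable radius next to `θ₀` missing the level set, which
  contradicts the Lebesgue density theorem (`IsUnifLocDoublingMeasure.ae_tendsto_measure_inter_div`).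

Consequences: `IsCNLFamily.measure_nearMiss_eq_zero` (hypothesis (b) for the discs of radius
`≥ 6R`) and **`SmirnovWerner2001_twoArm_scalingLimit_of_cnl_of_exponent`**: the named fact follows
from `exists_isCNLFamily_tendsto` and the continuum exponent `-1/4` alone (Smirnov–Werner 2001, §4:
(16) is then a theorem about the Camia–Newman limit, and (9) = (12) + (13) + (15) is the radial `SLE₆`
computation, Lawler–Schramm–Werner, Acta Math. 187 (2001), Thm 3.1, which stays a hypothesis).

Everything is proved; no definitions and no named facts are introduced.

## References

* S. Smirnov, W. Werner, Math. Res. Lett. 8 (2001) 729–744, §4 (9), (16) [SmirnovWernerMRL2001].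
* F. Camia, C. M. Newman, Comm. Math. Phys. 268 (2006), Thms 2, 7 and §6 [CamiaNewman2006].
* F. Camia, C. M. Newman, MSRI Publ. 55 (2008), Thms 2–3 [CamiaNewman2008].
-/

noncomputable section

open Set Metric Complex Filter MeasureTheory
open Literature.Probability.RandomPlanarGeometry
open scoped Topology ENNReal MatrixGroups UpperHalfPlane

namespace Literature.Probability.Percolation

open LatticeModels

/-! ### More on the hexagonal gauge -/

/-- The hexagonal gauge is continuous. [folklore] -/
theorem continuous_hexGauge : Continuous hexGauge := by
  have hX : Continuous triX := by unfold triX; fun_prop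
  have hY : Continuous triY := by unfold triY; fun_prop
  unfold hexGauge
  exact (continuous_abs.comp hX).max ((continuous_abs.comp hY).max (continuous_abs.comp (hX.add hY)))

/-- The gauge is positively homogeneous: `N(a z) = a N(z)` for `a ≥ 0`. [folklore] -/
theorem hexGauge_smul_of_nonneg {a : ℝ} (ha : 0 ≤ a) (z : ℂ) : hexGauge ((a : ℂ) * z) = a * hexGauge z := by
  rw [hexGauge, hexGauge, triX_smul, triY_smul, ← mul_add, abs_mul, abs_mul, abs_mul, abs_of_nonneg ha,
    ← mul_max_of_nonneg _ _ ha, ← mul_max_of_nonneg _ _ ha]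

/-- The gauge of the origin vanishes. [folklore] -/
theorem hexGauge_zero : hexGauge 0 = 0 := by
  have := hexGauge_ofReal (le_refl (0 : ℝ))
  rwa [Complex.ofReal_zero] at this

/-- `N(z) ≤ 2 ‖z‖`. [folklore] -/
theorem hexGauge_le_two_mul_norm (z : ℂ) : hexGauge z ≤ 2 * ‖z‖ := by
  have h := hexGauge_le_hexGauge_add z 0
  rwa [hexGauge_zero, zero_add, sub_zero] at h

/-- The gauge is subadditive. [folklore] -/
theorem hexGauge_add_le (z w : ℂ) : hexGauge (z + w) ≤ hexGauge z + hexGauge w := by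
  simp only [hexGauge, triX_add, triY_add]
  refine max_le ?_ (max_le ?_ ?_)
  · calc |triX z + triX w| ≤ |triX z| + |triX w| := abs_add_le _ _
      _ ≤ _ := add_le_add (le_max_left _ _) (le_max_left _ _)
  · calc |triY z + triY w| ≤ |triY z| + |triY w| := abs_add_le _ _
      _ ≤ _ := add_le_add ((le_max_left _ _).trans (le_max_right _ _))
          ((le_max_left _ _).trans (le_max_right _ _))
  · calc |triX z + triX w + (triY z + triY w)| = |(triX z + triY z) + (triX w + triY w)| := by ring_nf
      _ ≤ |triX z + triY z| + |triX w + triY w| := abs_add_le _ _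
      _ ≤ _ := add_le_add ((le_max_right _ _).trans (le_max_right _ _))
          ((le_max_right _ _).trans (le_max_right _ _))

/-- `‖z‖ ≤ 3 N(z)`: the gauge dominates the Euclidean norm up to a constant. [folklore] -/
theorem norm_le_three_mul_hexGauge (z : ℂ) : ‖z‖ ≤ 3 * hexGauge z := by
  have h3 : (1 : ℝ) ≤ Real.sqrt 3 := Real.one_le_sqrt.2 (by norm_num)
  have h3' : Real.sqrt 3 ≤ 2 := by
    rw [show (2 : ℝ) = Real.sqrt (2 ^ 2) by rw [Real.sqrt_sq zero_le_two]]
    exact Real.sqrt_le_sqrt (by norm_num)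
  have hpos : (0 : ℝ) < Real.sqrt 3 := by positivity
  have hX : |triX z| ≤ hexGauge z := le_max_left _ _
  have hY : |triY z| ≤ hexGauge z := (le_max_left _ _).trans (le_max_right _ _)
  have him : z.im = Real.sqrt 3 / 2 * triY z := by unfold triY; field_simp
  have hre : z.re = triX z + z.im / Real.sqrt 3 := by unfold triX; ring
  have h1 : |z.im| ≤ |triY z| := by
    rw [him, abs_mul, abs_of_pos (by positivity)]
    calc Real.sqrt 3 / 2 * |triY z| ≤ 1 * |triY z| := by gcongr; linarith
      _ = |triY z| := one_mul _
  have h2 : |z.re| ≤ |triX z| + |z.im| := by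
    rw [hre]
    calc |triX z + z.im / Real.sqrt 3| ≤ |triX z| + |z.im / Real.sqrt 3| := abs_add_le _ _
      _ ≤ |triX z| + |z.im| := by
          refine add_le_add le_rfl ?_
          rw [abs_div, abs_of_pos hpos]
          exact div_le_self (abs_nonneg _) h3
  calc ‖z‖ ≤ |z.re| + |z.im| := Complex.norm_le_abs_re_add_abs_im z
    _ ≤ |triX z| + 2 * |z.im| := by linarith
    _ ≤ hexGauge z + 2 * hexGauge z := by linarith [h1]
    _ = 3 * hexGauge z := by ring

/-- **Shrinking radially lowers the gauge**: if `E` is within `(2/25) σ ‖w‖` of `(1 - σ) w`,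
`0 < σ ≤ 1`, then `N(E) < N(w)` (for `N(w) > 0`). [folklore] -/
theorem hexGauge_lt_of_near_shrink {w E : ℂ} {t σ : ℝ} (ht : 0 < t) (hw : hexGauge w = t) (hσ : 0 < σ) (hσ1 : σ ≤ 1)
    (hE : ‖E - ((1 - σ : ℝ) : ℂ) * w‖ ≤ 2 / 25 * (σ * ‖w‖)) : hexGauge E < t := by
  have hwn : ‖w‖ ≤ 3 * t := hw ▸ norm_le_three_mul_hexGauge w
  have h1 : hexGauge E ≤ hexGauge (((1 - σ : ℝ) : ℂ) * w) + hexGauge (E - ((1 - σ : ℝ) : ℂ) * w) := by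
    have := hexGauge_add_le (((1 - σ : ℝ) : ℂ) * w) (E - ((1 - σ : ℝ) : ℂ) * w)
    rwa [add_sub_cancel] at this
  rw [hexGauge_smul_of_nonneg (by linarith), hw] at h1
  have h2 := hexGauge_le_two_mul_norm (E - ((1 - σ : ℝ) : ℂ) * w)
  nlinarith [mul_pos hσ ht, mul_le_mul_of_nonneg_left hwn hσ.le]

/-- **Expanding radially raises the gauge**: if `E` is within `(2/25) σ ‖w‖` of `(1 + σ) w`, `0 < σ`,
then `N(w) < N(E)` (for `N(w) > 0`). [folklore] -/
theorem lt_hexGauge_of_near_expand {w E : ℂ} {t σ : ℝ} (ht : 0 < t) (hw : hexGauge w = t) (hσ : 0 < σ)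
    (hE : ‖E - ((1 + σ : ℝ) : ℂ) * w‖ ≤ 2 / 25 * (σ * ‖w‖)) : t < hexGauge E := by
  have hwn : ‖w‖ ≤ 3 * t := hw ▸ norm_le_three_mul_hexGauge w
  have h1 : hexGauge (((1 + σ : ℝ) : ℂ) * w) ≤ hexGauge E + hexGauge (((1 + σ : ℝ) : ℂ) * w - E) := by
    have := hexGauge_add_le E (((1 + σ : ℝ) : ℂ) * w - E)
    rwa [add_sub_cancel] at this
  rw [hexGauge_smul_of_nonneg (by linarith), hw] at h1
  have h2 := hexGauge_le_two_mul_norm (((1 + σ : ℝ) : ℂ) * w - E)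
  rw [norm_sub_rev] at h2
  nlinarith [mul_pos hσ ht, mul_le_mul_of_nonneg_left hwn hσ.le]

/-! ### The first-order calculus of the Cayley transform -/

/-- **Increment estimate for the Cayley transform.** With `|D| ≥ 1`, `Δ = c + e`, `|e| ≤ |c|/30` and
`|c| ≤ 1/200`: `|ρ · 2iΔ/((D + Δ)D) - ρ · 2ic/D²| ≤ (2/25) |ρ · 2ic/D²|` — the increment
`C(η₀ + Δ) - C(η₀) = 2iΔ/((η₀ + i + Δ)(η₀ + i))` of the Cayley transform is its linearisation up to
`8%`. [folklore] -/
theorem norm_cayley_increment_sub_le (ρ : ℝ) {D Δ c e : ℂ} (hD : 1 ≤ ‖D‖) (hΔ : Δ = c + e)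
    (he : ‖e‖ ≤ ‖c‖ / 30) (hc : ‖c‖ ≤ 200⁻¹) :
    ‖(ρ : ℂ) * (2 * I * Δ / ((D + Δ) * D)) - (ρ : ℂ) * (2 * I * c / (D * D))‖ ≤
      2 / 25 * ‖(ρ : ℂ) * (2 * I * c / (D * D))‖ := by
  have hΔn : ‖Δ‖ ≤ 31 / 30 * ‖c‖ := by
    rw [hΔ]; exact (norm_add_le _ _).trans (by linarith)
  have hΔs : ‖Δ‖ ≤ 31 / 6000 := by linarith
  have hDpos : 0 < ‖D‖ := by linarith
  have hDne : D ≠ 0 := norm_pos_iff.1 hDpos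
  have hDΔ : ‖D‖ * (5969 / 6000) ≤ ‖D + Δ‖ := by
    have := norm_sub_norm_le D (-Δ)
    rw [sub_neg_eq_add, norm_neg] at this
    nlinarith
  have hDΔpos : 0 < ‖D + Δ‖ := by nlinarith
  have hDΔne : D + Δ ≠ 0 := norm_pos_iff.1 hDΔpos
  -- the algebraic identity
  have key : (ρ : ℂ) * (2 * I * Δ / ((D + Δ) * D)) - (ρ : ℂ) * (2 * I * c / (D * D)) =
      (ρ : ℂ) * (2 * I) * ((e * D - c * Δ) / ((D + Δ) * (D * D))) := by
    have he' : e = Δ - c := by rw [hΔ]; ring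
    rw [he']
    field_simp
    ring
  -- the numerator estimate
  have hnum : ‖e * D - c * Δ‖ ≤ 2 / 25 * ‖c‖ * ‖D + Δ‖ := by
    have h1 : ‖e * D - c * Δ‖ ≤ ‖e‖ * ‖D‖ + ‖c‖ * ‖Δ‖ := by
      calc ‖e * D - c * Δ‖ ≤ ‖e * D‖ + ‖c * Δ‖ := norm_sub_le _ _
        _ = ‖e‖ * ‖D‖ + ‖c‖ * ‖Δ‖ := by rw [norm_mul, norm_mul]
    have h2 : ‖e‖ * ‖D‖ ≤ ‖c‖ / 30 * ‖D‖ := mul_le_mul_of_nonneg_right he (norm_nonneg _)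
    have h3 : ‖c‖ * ‖Δ‖ ≤ ‖c‖ * (31 / 6000) * ‖D‖ := by
      calc ‖c‖ * ‖Δ‖ ≤ ‖c‖ * (31 / 6000) := mul_le_mul_of_nonneg_left hΔs (norm_nonneg _)
        _ = ‖c‖ * (31 / 6000) * 1 := (mul_one _).symm
        _ ≤ ‖c‖ * (31 / 6000) * ‖D‖ := mul_le_mul_of_nonneg_left hD (by positivity)
    have h4 : ‖c‖ * (‖D‖ * (5969 / 6000)) ≤ ‖c‖ * ‖D + Δ‖ := mul_le_mul_of_nonneg_left hDΔ (norm_nonneg _)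
    nlinarith [mul_nonneg (norm_nonneg c) (norm_nonneg D)]
  -- the norms of both sides
  have eL : ‖(ρ : ℂ) * (2 * I * Δ / ((D + Δ) * D)) - (ρ : ℂ) * (2 * I * c / (D * D))‖ =
      ‖(ρ : ℂ)‖ * 2 * (‖e * D - c * Δ‖ / (‖D + Δ‖ * (‖D‖ * ‖D‖))) := by
    rw [key]
    simp only [norm_mul, norm_div, Complex.norm_two, norm_I]
    ring
  have eR : ‖(ρ : ℂ) * (2 * I * c / (D * D))‖ = ‖(ρ : ℂ)‖ * 2 * (‖c‖ / (‖D‖ * ‖D‖)) := by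
    simp only [norm_mul, norm_div, Complex.norm_two, norm_I]
    ring
  rw [eL, eR]
  -- compare the two fractions
  have hfrac : ‖e * D - c * Δ‖ / (‖D + Δ‖ * (‖D‖ * ‖D‖)) ≤ 2 / 25 * (‖c‖ / (‖D‖ * ‖D‖)) := by
    rw [div_le_iff₀ (by positivity)]
    calc ‖e * D - c * Δ‖ ≤ 2 / 25 * ‖c‖ * ‖D + Δ‖ := hnum
      _ = 2 / 25 * (‖c‖ / (‖D‖ * ‖D‖)) * (‖D + Δ‖ * (‖D‖ * ‖D‖)) := by field_simp
  calc ‖(ρ : ℂ)‖ * 2 * (‖e * D - c * Δ‖ / (‖D + Δ‖ * (‖D‖ * ‖D‖)))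
      ≤ ‖(ρ : ℂ)‖ * 2 * (2 / 25 * (‖c‖ / (‖D‖ * ‖D‖))) := mul_le_mul_of_nonneg_left hfrac (by positivity)
    _ = 2 / 25 * (‖(ρ : ℂ)‖ * 2 * (‖c‖ / (‖D‖ * ‖D‖))) := by ring

/-! ### Invariance of the limit law under the Möbius automorphisms of the disc -/

/-- **The law of a CNL family in a disc is invariant under the Möbius automorphisms of the disc**
(conformal invariance, `IsCNLFamily.conformal_invariance`, applied to the automorphism
`ballMoebius ρ g` and its extension `ballMoebiusExt ρ g`): for a measurable set `B` of collections,
`ν D B = ν D ((LoopSpace.map Φ)⁻¹ B)`. [cite: CamiaNewman2006, Thm 7] -/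
theorem IsCNLFamily.measure_preimage_map_ballMoebiusExt {ν : JordanDomain → Measure (LoopSpace ℂ)}
    (hν : IsCNLFamily ν) {ρ : ℝ} (hρ : 0 < ρ) (g : SL(2, ℝ)) {B : Set (LoopSpace ℂ)} (hB : MeasurableSet B) :
    ν (JordanDomain.disc ρ hρ) B = ν (JordanDomain.disc ρ hρ) (LoopSpace.map (ballMoebiusExt ρ g) ⁻¹' B) := by
  have h := hν.conformal_invariance (JordanDomain.disc ρ hρ) (JordanDomain.disc ρ hρ) (ballMoebius ρ g hρ)
    (ballMoebiusExt ρ g) (eqOn_ballMoebiusExt g hρ) (mapsTo_ballMoebiusExt_closure g hρ)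
  conv_lhs => rw [h]
  rw [Measure.map_apply (LoopSpace.measurable_map_of_uniformContinuous (uniformContinuous_ballMoebiusExt ρ g)) hB]

/-! ### A uniform modulus of continuity for the shear family -/

/-- The maps `ballMoebiusExt ρ (shearSL θ)`, `‖θ‖ ≤ 1`, are equi-uniformly continuous on `ℂ` (joint
continuity on a compact set, and the radial retraction is Lipschitz). [folklore] -/
theorem exists_forall_dist_ballMoebiusExt_lt {ρ : ℝ} (hρ : 0 < ρ) {ε : ℝ} (hε : 0 < ε) :
    ∃ δ > 0, ∀ θ ∈ closedBall (0 : ℂ) 1, ∀ z z' : ℂ, dist z z' < δ →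
      dist (ballMoebiusExt ρ (shearSL θ) z) (ballMoebiusExt ρ (shearSL θ) z') < ε := by
  have hKc : IsCompact (closedBall (0 : ℂ) 1 ×ˢ closedBall (0 : ℂ) 1) :=
    (isCompact_closedBall 0 1).prod (isCompact_closedBall 0 1)
  have h1 : Continuous fun p : ℂ × ℂ ↦ (shearSL p.1, p.2) :=
    (continuous_shearSL.comp continuous_fst).prodMk continuous_snd
  have h1' : MapsTo (fun p : ℂ × ℂ ↦ (shearSL p.1, p.2)) (closedBall (0 : ℂ) 1 ×ˢ closedBall (0 : ℂ) 1)
      (univ ×ˢ closedBall 0 1) := fun p hp ↦ ⟨mem_univ _, hp.2⟩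
  have hfc := continuousOn_diskMoebius_uncurry.comp h1.continuousOn h1'
  have huc := hKc.uniformContinuousOn_of_continuous hfc
  rw [Metric.uniformContinuousOn_iff] at huc
  obtain ⟨δ, hδ, h⟩ := huc (ε / ρ) (div_pos hε hρ)
  refine ⟨ρ * δ / 2, by positivity, fun θ hθ z z' hzz' ↦ ?_⟩
  have hx : (θ, radialRetr (z / ρ)) ∈ closedBall (0 : ℂ) 1 ×ˢ closedBall (0 : ℂ) 1 := ⟨hθ, radialRetr_mem_closedBall _⟩
  have hy : (θ, radialRetr (z' / ρ)) ∈ closedBall (0 : ℂ) 1 ×ˢ closedBall (0 : ℂ) 1 := ⟨hθ, radialRetr_mem_closedBall _⟩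
  have hdist : dist (θ, radialRetr (z / ρ)) (θ, radialRetr (z' / ρ)) < δ := by
    rw [Prod.dist_eq, dist_self, max_eq_right dist_nonneg]
    have h1 := lipschitzWith_radialRetr.dist_le_mul (z / ρ) (z' / ρ)
    have h2 : dist (z / (ρ : ℂ)) (z' / ρ) = dist z z' / ρ := by
      rw [dist_eq_norm, ← sub_div, norm_div_ofReal hρ, ← dist_eq_norm]
    rw [h2] at h1
    calc dist (radialRetr (z / ρ)) (radialRetr (z' / ρ)) ≤ 2 * (dist z z' / ρ) := by exact_mod_cast h1
      _ < 2 * (ρ * δ / 2 / ρ) := by gcongr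
      _ = δ := by field_simp
  have key := h _ hx _ hy hdist
  simp only [Function.comp_apply] at key
  rw [ballMoebiusExt_apply, ballMoebiusExt_apply, dist_eq_norm, ← mul_sub, norm_mul, Complex.norm_real,
    Real.norm_eq_abs, abs_of_pos hρ, ← dist_eq_norm]
  calc ρ * dist (diskMoebius (shearSL θ) (radialRetr (z / ρ))) (diskMoebius (shearSL θ) (radialRetr (z' / ρ)))
      < ρ * (ε / ρ) := mul_lt_mul_of_pos_left key hρ
    _ = ε := by field_simp

/-- The distorted gauge `(θ, z) ↦ N(Φ_θ z)` is jointly continuous. [folklore] -/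
theorem continuous_hexGauge_ballMoebiusExt (ρ : ℝ) :
    Continuous fun p : ℂ × ℂ ↦ hexGauge (ballMoebiusExt ρ (shearSL p.1) p.2) := by
  have h1 : Continuous fun p : ℂ × ℂ ↦ (shearSL p.1, p.2) :=
    (continuous_shearSL.comp continuous_fst).prodMk continuous_snd
  have h2 := (continuous_ballMoebiusExt_uncurry ρ).comp h1
  have h3 := continuous_hexGauge.comp h2
  exact h3

/-- Continuity of the distorted gauge in the point, for a fixed parameter. [folklore] -/
theorem continuous_hexGauge_ballMoebiusExt_right (ρ : ℝ) (θ : ℂ) :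
    Continuous fun z : ℂ ↦ hexGauge (ballMoebiusExt ρ (shearSL θ) z) := by
  have h := (continuous_hexGauge_ballMoebiusExt ρ).comp (Continuous.prodMk_right θ)
  exact h

/-! ### Moving an image point radially along the shear family -/

/-- **Balls of parameters moving a given image point radially.** Let `‖θ₀‖ < 1/4`, `‖z‖ < ρ`, and let
the image point `w₀ = Φ_{θ₀} z` satisfy `0 < ‖w₀‖ ≤ ρ/2`. For `s = ±1` there are parameters `w_j`,
radii `δ_j → 0⁺` and proportions `σ_j ∈ (0, 1]` such that `θ₀ ∈ B̄(w_j, 5000 δ_j)` and for every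
`θ ∈ B̄(w_j, δ_j)` the image `Φ_θ z` is within `(2/25) σ_j ‖w₀‖` of `(1 + s σ_j) w₀`: through the
Cayley transform, `Φ_θ z = ρ C(η_θ)` with `η_θ = ζ + Re θ + (Im θ) ζ` affine in `θ`
(`ζ = C⁻¹(z/ρ)`), and the increment of `C` is its linearisation up to `8%`
(`norm_cayley_increment_sub_le`). [folklore] -/
theorem exists_balls_moving_radially {ρ : ℝ} (hρ : 0 < ρ) {θ₀ : ℂ} (hθ₀ : ‖θ₀‖ < 4⁻¹) {z : ℂ} (hz : ‖z‖ < ρ)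
    (hw : ‖ballMoebiusExt ρ (shearSL θ₀) z‖ ≤ ρ / 2) (hw0 : ballMoebiusExt ρ (shearSL θ₀) z ≠ 0)
    {s : ℝ} (hs : s = 1 ∨ s = -1) :
    ∃ (w : ℕ → ℂ) (δ σ : ℕ → ℝ), (∀ j, 0 < δ j) ∧ Tendsto δ atTop (𝓝 0) ∧ (∀ j, 0 < σ j ∧ σ j ≤ 1) ∧
      (∀ j, θ₀ ∈ closedBall (w j) (5000 * δ j)) ∧
      ∀ j, ∀ θ ∈ closedBall (w j) (δ j),
        ‖ballMoebiusExt ρ (shearSL θ) z - ((1 + s * σ j : ℝ) : ℂ) * ballMoebiusExt ρ (shearSL θ₀) z‖ ≤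
          2 / 25 * (σ j * ‖ballMoebiusExt ρ (shearSL θ₀) z‖) := by
  have hs1 : |s| = 1 := by rcases hs with rfl | rfl <;> simp
  -- the point of `ℍ` over `z` and the Cayley formula along the shear family
  set ζ : ℍ := ofDisc (z / ρ) (norm_div_lt_one hρ hz) with hζ
  have hform : ∀ θ : ℂ, ballMoebiusExt ρ (shearSL θ) z = ρ * cayleyFun ((shearSL θ • ζ : ℍ) : ℂ) :=
    fun θ ↦ ballMoebiusExt_eq_cayleyFun_smul (shearSL θ) hρ hz
  have hcoe : ∀ θ : ℂ, ‖θ‖ < 2⁻¹ → ((shearSL θ • ζ : ℍ) : ℂ) = (ζ : ℂ) + ((θ.re : ℂ) + (θ.im : ℂ) * ζ) :=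
    fun θ hθ ↦ coe_shearSL_smul_of_norm_lt hθ ζ
  have hθ₀' : ‖θ₀‖ < 2⁻¹ := hθ₀.trans (by norm_num)
  set η₀ : ℂ := ((shearSL θ₀ • ζ : ℍ) : ℂ) with hη₀
  set w₀ : ℂ := ballMoebiusExt ρ (shearSL θ₀) z with hw₀
  have hw₀η : w₀ = ρ * cayleyFun η₀ := hform θ₀
  have hw₀pos : 0 < ‖w₀‖ := norm_pos_iff.2 hw0
  set D : ℂ := η₀ + I with hD
  have hη₀im : 0 < η₀.im := (shearSL θ₀ • ζ).im_pos
  have hDne : D ≠ 0 := add_I_ne_zero hη₀im.le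
  have hDim : D.im = η₀.im + 1 := by simp [hD]
  have hD1 : 1 ≤ ‖D‖ := by
    have := Complex.abs_im_le_norm D
    rw [hDim, abs_of_pos (by linarith)] at this
    linarith
  -- `v = C η₀ = w₀ / ρ`, `‖v‖ ≤ 1/2`, `η₀ = C⁻¹ v`
  set v : ℂ := cayleyFun η₀ with hv
  have hvn : ‖v‖ ≤ 2⁻¹ := by
    have h1 : ‖w₀‖ = ρ * ‖v‖ := by rw [hw₀η, norm_mul, Complex.norm_real, Real.norm_eq_abs, abs_of_pos hρ]
    rw [h1] at hw
    nlinarith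
  have hη₀v : η₀ = cayleyInvFun v := (cayleyInvFun_cayleyFun hDne).symm
  -- bounds on `η₀` and `D`
  have h1v : 2⁻¹ ≤ ‖1 - v‖ := by
    have := norm_sub_norm_le (1 : ℂ) v
    rw [norm_one] at this
    linarith
  have h1v' : ‖1 + v‖ ≤ 3 / 2 := (norm_add_le _ _).trans (by rw [norm_one]; linarith)
  have hη₀n : ‖η₀‖ ≤ 3 := by
    rw [hη₀v, cayleyInvFun_apply, norm_div, norm_mul, norm_I, one_mul, div_le_iff₀ (by linarith)]
    linarith
  have hη₀i : 3⁻¹ ≤ η₀.im := by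
    rw [hη₀v, cayleyInvFun_im]
    have hnv : normSq v ≤ 4⁻¹ := by rw [normSq_eq_norm_sq]; nlinarith [norm_nonneg v]
    have h1v'' : ‖1 - v‖ ≤ 3 / 2 := (norm_sub_le _ _).trans (by rw [norm_one]; linarith)
    have hnd : normSq (1 - v) ≤ 9 / 4 := by rw [normSq_eq_norm_sq]; nlinarith [norm_nonneg (1 - v)]
    have hndpos : 0 < normSq (1 - v) := by rw [normSq_eq_norm_sq]; positivity
    rw [le_div_iff₀ hndpos]
    nlinarith
  have hD4 : ‖D‖ ≤ 4 := by
    calc ‖D‖ ≤ ‖η₀‖ + ‖I‖ := norm_add_le _ _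
      _ ≤ 4 := by rw [norm_I]; linarith
  -- bounds on `ζ` from `η₀ = ζ + Re θ₀ + (Im θ₀) ζ`
  have hζeq : η₀ = (ζ : ℂ) + ((θ₀.re : ℂ) + (θ₀.im : ℂ) * ζ) := hcoe θ₀ hθ₀'
  have hθ₀re : |θ₀.re| < 4⁻¹ := (Complex.abs_re_le_norm θ₀).trans_lt hθ₀
  have hθ₀im : |θ₀.im| < 4⁻¹ := (Complex.abs_im_le_norm θ₀).trans_lt hθ₀
  have hθ₀im' : 3 / 4 < 1 + θ₀.im := by have := neg_abs_le θ₀.im; linarith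
  have hθ₀im'' : 1 + θ₀.im < 5 / 4 := by have := le_abs_self θ₀.im; linarith
  have hζi0 : 0 < (ζ : ℂ).im := ζ.im_pos
  have hζim : (ζ : ℂ).im * (1 + θ₀.im) = η₀.im := by
    have := congrArg Complex.im hζeq
    simp only [add_im, ofReal_im, mul_im, ofReal_re, zero_mul, add_zero, zero_add] at this
    linarith
  have hζi : 4⁻¹ ≤ (ζ : ℂ).im := by nlinarith
  have hζn : ‖(ζ : ℂ)‖ ≤ 5 := by
    have h1 : ((1 + θ₀.im : ℝ) : ℂ) * ζ = η₀ - θ₀.re := by rw [hζeq]; push_cast; ring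
    have h2 : (1 + θ₀.im) * ‖(ζ : ℂ)‖ ≤ 3 + 4⁻¹ := by
      have := congrArg norm h1
      rw [norm_mul, Complex.norm_real, Real.norm_eq_abs, abs_of_pos (by linarith)] at this
      rw [this]
      calc ‖η₀ - θ₀.re‖ ≤ ‖η₀‖ + ‖(θ₀.re : ℂ)‖ := norm_sub_le _ _
        _ ≤ 3 + 4⁻¹ := by rw [Complex.norm_real, Real.norm_eq_abs]; linarith
    nlinarith [norm_nonneg (ζ : ℂ)]
  -- the linear map `Λ` and its inverse
  set Λ : ℂ → ℂ := fun x ↦ (x.re : ℂ) + (x.im : ℂ) * ζ with hΛ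
  set Λi : ℂ → ℂ := fun u ↦ ((u.re - u.im / (ζ : ℂ).im * (ζ : ℂ).re : ℝ) : ℂ) +
    ((u.im / (ζ : ℂ).im : ℝ) : ℂ) * I with hΛi
  have hΛΛi : ∀ u, Λ (Λi u) = u := by
    intro u
    have hre : (Λi u).re = u.re - u.im / (ζ : ℂ).im * (ζ : ℂ).re := by simp [hΛi]
    have him : (Λi u).im = u.im / (ζ : ℂ).im := by simp [hΛi]
    apply Complex.ext
    · simp only [hΛ, hre, him, add_re, ofReal_re, mul_re, ofReal_im, zero_mul, sub_zero]
      ring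
    · simp only [hΛ, hre, him, add_im, ofReal_im, mul_im, ofReal_re, zero_mul, add_zero, zero_add]
      field_simp
  have hΛadd : ∀ x y, Λ (x + y) = Λ x + Λ y := by
    intro x y; simp only [hΛ, add_re, add_im]; push_cast; ring
  have hΛsub : ∀ x y, Λ (x - y) = Λ x - Λ y := by
    intro x y; simp only [hΛ, sub_re, sub_im]; push_cast; ring
  have hΛn : ∀ x, ‖Λ x‖ ≤ 6 * ‖x‖ := by
    intro x
    calc ‖Λ x‖ ≤ ‖(x.re : ℂ)‖ + ‖(x.im : ℂ) * ζ‖ := norm_add_le _ _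
      _ = |x.re| + |x.im| * ‖(ζ : ℂ)‖ := by
          rw [norm_mul, Complex.norm_real, Complex.norm_real, Real.norm_eq_abs, Real.norm_eq_abs]
      _ ≤ ‖x‖ + ‖x‖ * 5 := add_le_add (Complex.abs_re_le_norm x)
          (mul_le_mul (Complex.abs_im_le_norm x) hζn (norm_nonneg _) (norm_nonneg _))
      _ = 6 * ‖x‖ := by ring
  have hΛin : ∀ u, ‖Λi u‖ ≤ 25 * ‖u‖ := by
    intro u
    have hi : (ζ : ℂ).im⁻¹ ≤ 4 := by rw [inv_le_comm₀ hζi0 (by norm_num)]; exact hζi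
    have hure := Complex.abs_re_le_norm u
    have huim := Complex.abs_im_le_norm u
    have hζre : |(ζ : ℂ).re| ≤ 5 := (Complex.abs_re_le_norm _).trans hζn
    have h1 : |u.im / (ζ : ℂ).im| ≤ 4 * ‖u‖ := by
      rw [abs_div, abs_of_pos hζi0, div_eq_mul_inv]
      calc |u.im| * (ζ : ℂ).im⁻¹ ≤ ‖u‖ * 4 := mul_le_mul huim hi (inv_nonneg.2 hζi0.le) (norm_nonneg _)
        _ = 4 * ‖u‖ := by ring
    calc ‖Λi u‖ ≤ ‖((u.re - u.im / (ζ : ℂ).im * (ζ : ℂ).re : ℝ) : ℂ)‖ + ‖((u.im / (ζ : ℂ).im : ℝ) : ℂ) * I‖ :=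
          norm_add_le _ _
      _ = |u.re - u.im / (ζ : ℂ).im * (ζ : ℂ).re| + |u.im / (ζ : ℂ).im| := by
          rw [norm_mul, norm_I, mul_one, Complex.norm_real, Complex.norm_real, Real.norm_eq_abs, Real.norm_eq_abs]
      _ ≤ (|u.re| + |u.im / (ζ : ℂ).im| * |(ζ : ℂ).re|) + |u.im / (ζ : ℂ).im| := by
          gcongr
          calc |u.re - u.im / (ζ : ℂ).im * (ζ : ℂ).re| ≤ |u.re| + |u.im / (ζ : ℂ).im * (ζ : ℂ).re| := abs_sub _ _
            _ = |u.re| + |u.im / (ζ : ℂ).im| * |(ζ : ℂ).re| := by rw [abs_mul]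
      _ ≤ (‖u‖ + 4 * ‖u‖ * 5) + 4 * ‖u‖ := by
          gcongr
      _ = 25 * ‖u‖ := by ring
  -- the scales
  set M₀ : ℝ := ‖w₀‖ * ‖D‖ ^ 2 / (2 * ρ) with hM₀
  have hM₀pos : 0 < M₀ := by positivity
  set σmax : ℝ := min 1 (200 * M₀)⁻¹ with hσmax
  have hσmaxpos : 0 < σmax := lt_min one_pos (by positivity)
  set σ : ℕ → ℝ := fun j ↦ σmax / ((j : ℝ) + 2) with hσ
  have hσpos : ∀ j, 0 < σ j := fun j ↦ by positivity
  have hσle : ∀ j, σ j ≤ σmax := fun j ↦ by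
    rw [hσ]; dsimp only
    rw [div_le_iff₀ (by positivity)]
    nlinarith [(by positivity : (0 : ℝ) ≤ j)]
  have hσ1 : ∀ j, σ j ≤ 1 := fun j ↦ (hσle j).trans (min_le_left _ _)
  have hσM : ∀ j, σ j * M₀ ≤ 200⁻¹ := fun j ↦ by
    calc σ j * M₀ ≤ σmax * M₀ := mul_le_mul_of_nonneg_right (hσle j) hM₀pos.le
      _ ≤ (200 * M₀)⁻¹ * M₀ := mul_le_mul_of_nonneg_right (min_le_right _ _) hM₀pos.le
      _ = 200⁻¹ := by field_simp
  set c : ℕ → ℂ := fun j ↦ ((s * σ j : ℝ) : ℂ) * w₀ * (D * D) / (2 * I * ρ) with hc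
  have hρne : (ρ : ℂ) ≠ 0 := by exact_mod_cast hρ.ne'
  have h2I : (2 : ℂ) * I ≠ 0 := mul_ne_zero two_ne_zero I_ne_zero
  have hckey : ∀ j, (ρ : ℂ) * (2 * I * c j / (D * D)) = ((s * σ j : ℝ) : ℂ) * w₀ := by
    intro j
    simp only [hc]
    field_simp
  have hcn : ∀ j, ‖c j‖ = σ j * M₀ := by
    intro j
    simp only [hc, hM₀]
    rw [norm_div, norm_mul, norm_mul, norm_mul, norm_mul, norm_mul, Complex.norm_real, Complex.norm_real,
      Complex.norm_two, norm_I, mul_one, Real.norm_eq_abs, Real.norm_eq_abs, abs_mul, hs1, one_mul,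
      abs_of_pos (hσpos j), abs_of_pos hρ]
    ring
  have hcpos : ∀ j, 0 < ‖c j‖ := fun j ↦ by rw [hcn]; exact mul_pos (hσpos j) hM₀pos
  have hc200 : ∀ j, ‖c j‖ ≤ 200⁻¹ := fun j ↦ by rw [hcn]; exact hσM j
  -- the balls
  refine ⟨fun j ↦ θ₀ + Λi (c j), fun j ↦ ‖c j‖ / 200, σ, fun j ↦ div_pos (hcpos j) (by norm_num), ?_,
    fun j ↦ ⟨hσpos j, hσ1 j⟩, fun j ↦ ?_, fun j θ hθ ↦ ?_⟩
  · -- `δ j → 0`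
    have h1 : Tendsto (fun j : ℕ ↦ σmax / ((j : ℝ) + 2)) atTop (𝓝 0) := by
      exact tendsto_const_nhds.div_atTop (tendsto_atTop_add_const_right atTop (2 : ℝ) tendsto_natCast_atTop_atTop)
    have h2 : Tendsto (fun j : ℕ ↦ σmax / ((j : ℝ) + 2) * M₀ / 200) atTop (𝓝 (0 * M₀ / 200)) :=
      (h1.mul_const M₀).div_const 200
    rw [zero_mul, zero_div] at h2
    refine h2.congr fun j ↦ ?_
    rw [hcn]
  · -- `θ₀` is within `5000 δ j` of the centre
    rw [mem_closedBall, dist_eq_norm, sub_add_cancel_left, norm_neg]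
    calc ‖Λi (c j)‖ ≤ 25 * ‖c j‖ := hΛin (c j)
      _ = 5000 * (‖c j‖ / 200) := by ring
  · -- the radial motion on the ball
    rw [mem_closedBall, dist_eq_norm] at hθ
    have hθn : ‖θ‖ < 2⁻¹ := by
      calc ‖θ‖ = ‖(θ - (θ₀ + Λi (c j))) + Λi (c j) + θ₀‖ := by ring_nf
        _ ≤ ‖θ - (θ₀ + Λi (c j))‖ + ‖Λi (c j)‖ + ‖θ₀‖ := norm_add₃_le
        _ ≤ ‖c j‖ / 200 + 25 * ‖c j‖ + ‖θ₀‖ := by gcongr; exact hΛin (c j)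
        _ < 2⁻¹ := by have := hc200 j; linarith
    set Δ : ℂ := Λ (θ - θ₀) with hΔ
    set e : ℂ := Λ (θ - (θ₀ + Λi (c j))) with he
    have hΔce : Δ = c j + e := by
      rw [hΔ, he, show θ - θ₀ = Λi (c j) + (θ - (θ₀ + Λi (c j))) by ring, hΛadd, hΛΛi]
    have hen : ‖e‖ ≤ ‖c j‖ / 30 := by
      calc ‖e‖ ≤ 6 * ‖θ - (θ₀ + Λi (c j))‖ := hΛn _
        _ ≤ 6 * (‖c j‖ / 200) := by gcongr
        _ ≤ ‖c j‖ / 30 := by linarith [norm_nonneg (c j)]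
    have hηθ : ((shearSL θ • ζ : ℍ) : ℂ) = η₀ + Δ := by
      rw [hcoe θ hθn, hζeq, hΔ, hΛsub]
      simp only [hΛ]
      ring
    have hsub := cayleyFun_sub_cayleyFun (shearSL θ • ζ) (shearSL θ₀ • ζ)
    rw [hηθ, ← hη₀] at hsub
    have hsub' : cayleyFun (η₀ + Δ) = cayleyFun η₀ + 2 * I * Δ / ((D + Δ) * D) := by
      rw [sub_eq_iff_eq_add'] at hsub
      rw [hsub, hD]
      ring
    have hexpr : ballMoebiusExt ρ (shearSL θ) z - ((1 + s * σ j : ℝ) : ℂ) * w₀ =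
        (ρ : ℂ) * (2 * I * Δ / ((D + Δ) * D)) - (ρ : ℂ) * (2 * I * c j / (D * D)) := by
      rw [hckey, hform θ, hηθ, hw₀η, hsub', ← hv]
      push_cast
      ring
    rw [hexpr]
    calc ‖(ρ : ℂ) * (2 * I * Δ / ((D + Δ) * D)) - (ρ : ℂ) * (2 * I * c j / (D * D))‖
        ≤ 2 / 25 * ‖(ρ : ℂ) * (2 * I * c j / (D * D))‖ := norm_cayley_increment_sub_le ρ hD1 hΔce hen (hc200 j)
      _ = 2 / 25 * (σ j * ‖w₀‖) := by
          rw [hckey, norm_mul, Complex.norm_real, Real.norm_eq_abs, abs_mul, hs1, one_mul, abs_of_pos (hσpos j)]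

/-! ### Level sets of the distorted extrema are Lebesgue-null -/

/-- **A porous set is Lebesgue-null** (Lebesgue density theorem, form with moving centres,
`IsUnifLocDoublingMeasure.ae_tendsto_measure_inter_div`): a measurable `Z ⊆ ℂ` every point `θ₀` of
which admits balls `B̄(w_j, δ_j)` missing `Z` with `δ_j → 0⁺` and `θ₀ ∈ B̄(w_j, 5000 δ_j)` is null. [folklore] -/
theorem volume_eq_zero_of_balls_missing {Z : Set ℂ} (hZ : MeasurableSet Z)
    (h : ∀ θ₀ ∈ Z, ∃ (w : ℕ → ℂ) (δ : ℕ → ℝ), (∀ j, 0 < δ j) ∧ Tendsto δ atTop (𝓝 0) ∧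
      (∀ j, θ₀ ∈ closedBall (w j) (5000 * δ j)) ∧ ∀ j, Z ∩ closedBall (w j) (δ j) = ∅) :
    volume Z = 0 := by
  have hd := IsUnifLocDoublingMeasure.ae_tendsto_measure_inter_div (volume : Measure ℂ) Z 5000
  have hm := ae_restrict_mem (μ := (volume : Measure ℂ)) hZ
  have hfalse : ∀ᵐ θ₀ ∂(volume : Measure ℂ).restrict Z, False := by
    filter_upwards [hd, hm] with θ₀ hθd hθZ
    obtain ⟨w, δ, hδpos, hδ0, hmem, hmiss⟩ := h θ₀ hθZ
    have hδ0' : Tendsto δ atTop (𝓝[>] 0) :=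
      tendsto_nhdsWithin_iff.2 ⟨hδ0, Eventually.of_forall hδpos⟩
    have hlim := hθd w δ hδ0' (Eventually.of_forall hmem)
    have hzero : (fun j ↦ volume (Z ∩ closedBall (w j) (δ j)) / volume (closedBall (w j) (δ j))) = fun _ ↦ 0 := by
      funext j; rw [hmiss j, measure_empty, ENNReal.zero_div]
    rw [hzero] at hlim
    exact zero_ne_one (tendsto_nhds_unique tendsto_const_nhds hlim)
  have : (volume : Measure ℂ).restrict Z = 0 := ae_eq_bot.1 (eventually_false_iff_eq_bot.1 hfalse)
  exact Measure.restrict_eq_zero.1 this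

/-- **Level sets of the distorted minimum are null.** For a compact nonempty `s ⊆ ℂ`, `0 < t`,
`3 t ≤ ρ/2`, the parameters `θ`, `‖θ‖ < 1/4`, at which `min_{z ∈ s} N(Φ_θ z) = t` form a
Lebesgue-null set: at such `θ₀` the minimum is attained at some `z` with `‖z‖ < ρ` (points with
`‖z‖ ≥ ρ` are sent to the circle of radius `ρ`, where `N ≥ ρ/3 > t`), and moving `Φ_θ z` radially
inwards (`exists_balls_moving_radially` with `s = -1`, `hexGauge_lt_of_near_shrink`) gives balls of
parameters where the minimum is `< t`. [folklore] -/
theorem volume_levelSet_min_eq_zero {ρ t : ℝ} (hρ : 0 < ρ) (ht : 0 < t) (htρ : 3 * t ≤ ρ / 2)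
    {s : Set ℂ} (hs : IsCompact s) (hne : s.Nonempty) :
    volume {θ : ℂ | θ ∈ ball (0 : ℂ) 4⁻¹ ∧
      sInf ((fun z ↦ hexGauge (ballMoebiusExt ρ (shearSL θ) z)) '' s) = t} = 0 := by
  have hG := continuous_hexGauge_ballMoebiusExt ρ
  have hGθ : ∀ θ : ℂ, Continuous fun z ↦ hexGauge (ballMoebiusExt ρ (shearSL θ) z) :=
    continuous_hexGauge_ballMoebiusExt_right ρ
  have hcont : Continuous fun θ : ℂ ↦ sInf ((fun z ↦ hexGauge (ballMoebiusExt ρ (shearSL θ) z)) '' s) :=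
    hs.continuous_sInf (f := fun θ z ↦ hexGauge (ballMoebiusExt ρ (shearSL θ) z)) hG
  have hZ : MeasurableSet {θ : ℂ | θ ∈ ball (0 : ℂ) 4⁻¹ ∧
      sInf ((fun z ↦ hexGauge (ballMoebiusExt ρ (shearSL θ) z)) '' s) = t} :=
    measurableSet_ball.inter ((isClosed_singleton.preimage hcont).measurableSet)
  refine volume_eq_zero_of_balls_missing hZ fun θ₀ ⟨hθ₀, hθ₀t⟩ ↦ ?_
  rw [mem_ball_zero_iff] at hθ₀
  -- a minimiser
  obtain ⟨z, hzs, hzmin⟩ := hs.exists_isMinOn hne (hGθ θ₀).continuousOn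
  have hzt : hexGauge (ballMoebiusExt ρ (shearSL θ₀) z) = t := by
    refine le_antisymm ?_ ?_
    · rw [← hθ₀t]
      refine le_csInf (hne.image _) ?_
      rintro _ ⟨z', hz', rfl⟩
      exact hzmin hz'
    · rw [← hθ₀t]
      exact csInf_le (hs.bddBelow_image (hGθ θ₀).continuousOn) (mem_image_of_mem _ hzs)
  -- the minimiser lies in the open disc
  have hzρ : ‖z‖ < ρ := by
    by_contra hcon
    push Not at hcon
    have h1 := norm_ballMoebiusExt_of_le (shearSL θ₀) hρ hcon
    have h2 := norm_le_three_mul_hexGauge (ballMoebiusExt ρ (shearSL θ₀) z)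
    rw [h1, hzt] at h2
    linarith
  have hw : ‖ballMoebiusExt ρ (shearSL θ₀) z‖ ≤ ρ / 2 :=
    ((norm_le_three_mul_hexGauge _).trans (by rw [hzt])).trans htρ
  have hw0 : ballMoebiusExt ρ (shearSL θ₀) z ≠ 0 := by
    intro h0; rw [h0, hexGauge_zero] at hzt; exact ht.ne hzt
  obtain ⟨w, δ, σ, hδpos, hδ0, hσ, hmem, hmove⟩ :=
    exists_balls_moving_radially hρ hθ₀ hzρ hw hw0 (s := -1) (Or.inr rfl)
  refine ⟨w, δ, hδpos, hδ0, hmem, fun j ↦ eq_empty_of_forall_notMem fun θ ⟨⟨_, hθt⟩, hθ⟩ ↦ ?_⟩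
  have h1 := hmove j θ hθ
  rw [show (1 + -1 * σ j : ℝ) = 1 - σ j by ring] at h1
  have hlt := hexGauge_lt_of_near_shrink ht hzt (hσ j).1 (hσ j).2 h1
  have hle : sInf ((fun z ↦ hexGauge (ballMoebiusExt ρ (shearSL θ) z)) '' s) ≤
      hexGauge (ballMoebiusExt ρ (shearSL θ) z) :=
    csInf_le (hs.bddBelow_image (hGθ θ).continuousOn) (mem_image_of_mem _ hzs)
  rw [hθt] at hle
  exact absurd hlt (not_lt.2 hle)

/-- **Level sets of the distorted maximum are null** (as `volume_levelSet_min_eq_zero`, moving the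
maximiser radially outwards: `exists_balls_moving_radially` with `s = 1`,
`lt_hexGauge_of_near_expand`). [folklore] -/
theorem volume_levelSet_max_eq_zero {ρ t : ℝ} (hρ : 0 < ρ) (ht : 0 < t) (htρ : 3 * t ≤ ρ / 2)
    {s : Set ℂ} (hs : IsCompact s) (hne : s.Nonempty) :
    volume {θ : ℂ | θ ∈ ball (0 : ℂ) 4⁻¹ ∧
      sSup ((fun z ↦ hexGauge (ballMoebiusExt ρ (shearSL θ) z)) '' s) = t} = 0 := by
  have hG := continuous_hexGauge_ballMoebiusExt ρ
  have hGθ : ∀ θ : ℂ, Continuous fun z ↦ hexGauge (ballMoebiusExt ρ (shearSL θ) z) :=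
    continuous_hexGauge_ballMoebiusExt_right ρ
  have hcont : Continuous fun θ : ℂ ↦ sSup ((fun z ↦ hexGauge (ballMoebiusExt ρ (shearSL θ) z)) '' s) :=
    hs.continuous_sSup (f := fun θ z ↦ hexGauge (ballMoebiusExt ρ (shearSL θ) z)) hG
  have hZ : MeasurableSet {θ : ℂ | θ ∈ ball (0 : ℂ) 4⁻¹ ∧
      sSup ((fun z ↦ hexGauge (ballMoebiusExt ρ (shearSL θ) z)) '' s) = t} :=
    measurableSet_ball.inter ((isClosed_singleton.preimage hcont).measurableSet)
  refine volume_eq_zero_of_balls_missing hZ fun θ₀ ⟨hθ₀, hθ₀t⟩ ↦ ?_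
  rw [mem_ball_zero_iff] at hθ₀
  obtain ⟨z, hzs, hzmax⟩ := hs.exists_isMaxOn hne (hGθ θ₀).continuousOn
  have hzt : hexGauge (ballMoebiusExt ρ (shearSL θ₀) z) = t := by
    refine le_antisymm ?_ ?_
    · rw [← hθ₀t]
      exact le_csSup (hs.bddAbove_image (hGθ θ₀).continuousOn) (mem_image_of_mem _ hzs)
    · rw [← hθ₀t]
      refine csSup_le (hne.image _) ?_
      rintro _ ⟨z', hz', rfl⟩
      exact hzmax hz'
  have hzρ : ‖z‖ < ρ := by
    by_contra hcon
    push Not at hcon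
    have h1 := norm_ballMoebiusExt_of_le (shearSL θ₀) hρ hcon
    have h2 := norm_le_three_mul_hexGauge (ballMoebiusExt ρ (shearSL θ₀) z)
    rw [h1, hzt] at h2
    linarith
  have hw : ‖ballMoebiusExt ρ (shearSL θ₀) z‖ ≤ ρ / 2 :=
    ((norm_le_three_mul_hexGauge _).trans (by rw [hzt])).trans htρ
  have hw0 : ballMoebiusExt ρ (shearSL θ₀) z ≠ 0 := by
    intro h0; rw [h0, hexGauge_zero] at hzt; exact ht.ne hzt
  obtain ⟨w, δ, σ, hδpos, hδ0, hσ, hmem, hmove⟩ :=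
    exists_balls_moving_radially hρ hθ₀ hzρ hw hw0 (s := 1) (Or.inl rfl)
  refine ⟨w, δ, hδpos, hδ0, hmem, fun j ↦ eq_empty_of_forall_notMem fun θ ⟨⟨_, hθt⟩, hθ⟩ ↦ ?_⟩
  have h1 := hmove j θ hθ
  rw [show (1 + 1 * σ j : ℝ) = 1 + σ j by ring] at h1
  have hlt := lt_hexGauge_of_near_expand ht hzt (hσ j).1 h1
  have hle : hexGauge (ballMoebiusExt ρ (shearSL θ) z) ≤
      sSup ((fun z ↦ hexGauge (ballMoebiusExt ρ (shearSL θ) z)) '' s) :=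
    le_csSup (hs.bddAbove_image (hGθ θ).continuousOn) (mem_image_of_mem _ hzs)
  rw [hθt] at hle
  exact absurd hlt (not_lt.2 hle)

/-! ### The parameters at which a given collection near-misses -/

/-- **For a collection with finitely many large traces, the near-miss parameters lie in finitely many
level sets.** Let `δ₁ > 0` be a uniform modulus for `ε = (R - r)/4` of the maps `Φ_θ`, `‖θ‖ ≤ 1`
(`exists_forall_dist_ballMoebiusExt_lt`), and let the traces of `L` of diameter `> δ₁/2` form a
finite set `𝒯`. If `L` near-misses the annulus `(r, R)` for the distorted gauge `N ∘ Φ_θ`,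
`‖θ‖ < 1/4`, then for some `s ∈ 𝒯` either `min_s N ∘ Φ_θ = r` or `max_s N ∘ Φ_θ = R`: the members
`c_n` witnessing the `1/(n+1)`-near crossings have traces of diameter `> δ₁/2`, one trace `s` serves
infinitely many `n` (pigeonhole), so `min_s ≤ r` and `max_s ≥ R` by compactness, while
`min_s < r` together with `max_s > R` is excluded by the no-strict-crossing clause. [folklore] -/
theorem setOf_nearMiss_param_subset {ρ r R δ₁ : ℝ} (hrR : r < R) (hδ₁ : 0 < δ₁)
    (hmod : ∀ θ ∈ closedBall (0 : ℂ) 1, ∀ z z' : ℂ, dist z z' < δ₁ →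
      dist (ballMoebiusExt ρ (shearSL θ) z) (ballMoebiusExt ρ (shearSL θ) z') < (R - r) / 4)
    (L : LoopSpace ℂ) (hfin : {s : Set ℂ | ∃ c ∈ L, CurveClass.range c = s ∧ δ₁ / 2 < diam s}.Finite) :
    {θ : ℂ | θ ∈ ball (0 : ℂ) 4⁻¹ ∧
      ((∀ n : ℕ, ∃ c ∈ L, (∃ z ∈ CurveClass.range c, hexGauge (ballMoebiusExt ρ (shearSL θ) z) < r + ((n : ℝ) + 1)⁻¹) ∧
        ∃ z ∈ CurveClass.range c, R - ((n : ℝ) + 1)⁻¹ < hexGauge (ballMoebiusExt ρ (shearSL θ) z)) ∧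
      ¬ ∃ c ∈ L, (∃ z ∈ CurveClass.range c, hexGauge (ballMoebiusExt ρ (shearSL θ) z) < r) ∧
        ∃ z ∈ CurveClass.range c, R < hexGauge (ballMoebiusExt ρ (shearSL θ) z))} ⊆
    ⋃ s ∈ {s : Set ℂ | ∃ c ∈ L, CurveClass.range c = s ∧ δ₁ / 2 < diam s},
      ({θ : ℂ | θ ∈ ball (0 : ℂ) 4⁻¹ ∧ sInf ((fun z ↦ hexGauge (ballMoebiusExt ρ (shearSL θ) z)) '' s) = r} ∪
       {θ : ℂ | θ ∈ ball (0 : ℂ) 4⁻¹ ∧ sSup ((fun z ↦ hexGauge (ballMoebiusExt ρ (shearSL θ) z)) '' s) = R}) := by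
  classical
  rintro θ ⟨hθ, hall, hneg⟩
  have hθ1 : θ ∈ closedBall (0 : ℂ) 1 := by
    rw [mem_closedBall_zero_iff]; rw [mem_ball_zero_iff] at hθ; linarith
  set G : ℂ → ℝ := fun z ↦ hexGauge (ballMoebiusExt ρ (shearSL θ) z) with hGdef
  have hGc : Continuous G := continuous_hexGauge_ballMoebiusExt_right ρ θ
  set 𝒯 : Set (Set ℂ) := {s : Set ℂ | ∃ c ∈ L, CurveClass.range c = s ∧ δ₁ / 2 < diam s} with h𝒯
  choose c hcL hc using hall
  choose z₁ hz₁ h₁ using fun n ↦ (hc n).1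
  choose z₂ hz₂ h₂ using fun n ↦ (hc n).2
  -- from some `n₀` on, the witnessing traces are large
  obtain ⟨n₀, hn₀⟩ := exists_nat_one_div_lt (by linarith : (0 : ℝ) < (R - r) / 4)
  rw [one_div] at hn₀
  have hlarge : ∀ n, n₀ ≤ n → CurveClass.range (c n) ∈ 𝒯 := by
    intro n hn
    refine ⟨c n, hcL n, rfl, ?_⟩
    have hn' : ((n : ℝ) + 1)⁻¹ ≤ ((n₀ : ℝ) + 1)⁻¹ := by
      apply inv_anti₀ (by positivity); exact_mod_cast Nat.add_le_add_right hn 1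
    -- the two image points are far apart
    have hfar : (R - r) / 4 ≤ dist (ballMoebiusExt ρ (shearSL θ) (z₁ n)) (ballMoebiusExt ρ (shearSL θ) (z₂ n)) := by
      have hg := hexGauge_le_hexGauge_add (ballMoebiusExt ρ (shearSL θ) (z₂ n)) (ballMoebiusExt ρ (shearSL θ) (z₁ n))
      rw [← dist_eq_norm, dist_comm] at hg
      have := h₁ n; have := h₂ n
      simp only [hGdef] at *
      linarith
    -- hence so are the points themselves
    have hzz : δ₁ ≤ dist (z₁ n) (z₂ n) := by
      by_contra hcon
      push Not at hcon
      have := hmod θ hθ1 (z₁ n) (z₂ n) hcon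
      linarith
    have hdiam : dist (z₁ n) (z₂ n) ≤ diam (CurveClass.range (c n)) :=
      dist_le_diam_of_mem (CurveClass.isCompact_range _).isBounded (hz₁ n) (hz₂ n)
    linarith
  -- pigeonhole: one large trace serves infinitely many `n`
  haveI : Finite 𝒯 := hfin.to_subtype
  set f : ℕ → 𝒯 := fun n ↦ ⟨CurveClass.range (c (n + n₀)), hlarge _ (Nat.le_add_left _ _)⟩ with hf
  obtain ⟨⟨s, hs𝒯⟩, hinf⟩ := Finite.exists_infinite_fiber f
  have hA : (f ⁻¹' {⟨s, hs𝒯⟩}).Infinite := Set.infinite_coe_iff.1 hinf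
  have hAmem : ∀ n ∈ f ⁻¹' {⟨s, hs𝒯⟩}, CurveClass.range (c (n + n₀)) = s := by
    intro n hn
    have := congrArg Subtype.val (mem_singleton_iff.1 hn)
    exact this
  obtain ⟨c₀, hc₀L, hc₀s, -⟩ := id hs𝒯
  have hsc : IsCompact s := hc₀s ▸ CurveClass.isCompact_range c₀
  have hsne : s.Nonempty := hc₀s ▸ CurveClass.range_nonempty c₀
  have hbb : BddBelow (G '' s) := hsc.bddBelow_image hGc.continuousOn
  have hba : BddAbove (G '' s) := hsc.bddAbove_image hGc.continuousOn
  -- `min_s G ≤ r` and `max_s G ≥ R`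
  have hinf_le : sInf (G '' s) ≤ r := by
    refine le_of_forall_pos_lt_add fun ε hε ↦ ?_
    obtain ⟨N, hN⟩ := exists_nat_one_div_lt hε
    rw [one_div] at hN
    obtain ⟨n, hn, hNn⟩ := hA.exists_gt N
    have hn' : ((n + n₀ : ℕ) : ℝ) + 1 ≥ (N : ℝ) + 1 := by
      have h1 : (N : ℝ) < n := by exact_mod_cast hNn
      have h2 : (0 : ℝ) ≤ n₀ := Nat.cast_nonneg _
      push_cast
      linarith
    have hinv : (((n + n₀ : ℕ) : ℝ) + 1)⁻¹ ≤ ((N : ℝ) + 1)⁻¹ := inv_anti₀ (by positivity) hn'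
    have hz : z₁ (n + n₀) ∈ s := hAmem n hn ▸ hz₁ (n + n₀)
    calc sInf (G '' s) ≤ G (z₁ (n + n₀)) := csInf_le hbb (mem_image_of_mem _ hz)
      _ < r + (((n + n₀ : ℕ) : ℝ) + 1)⁻¹ := h₁ (n + n₀)
      _ < r + ε := by linarith
  have hsup_ge : R ≤ sSup (G '' s) := by
    refine le_of_forall_pos_lt_add fun ε hε ↦ ?_
    obtain ⟨N, hN⟩ := exists_nat_one_div_lt hε
    rw [one_div] at hN
    obtain ⟨n, hn, hNn⟩ := hA.exists_gt N
    have hn' : ((n + n₀ : ℕ) : ℝ) + 1 ≥ (N : ℝ) + 1 := by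
      have h1 : (N : ℝ) < n := by exact_mod_cast hNn
      have h2 : (0 : ℝ) ≤ n₀ := Nat.cast_nonneg _
      push_cast
      linarith
    have hinv : (((n + n₀ : ℕ) : ℝ) + 1)⁻¹ ≤ ((N : ℝ) + 1)⁻¹ := inv_anti₀ (by positivity) hn'
    have hz : z₂ (n + n₀) ∈ s := hAmem n hn ▸ hz₂ (n + n₀)
    calc R < G (z₂ (n + n₀)) + (((n + n₀ : ℕ) : ℝ) + 1)⁻¹ := by linarith [h₂ (n + n₀)]
      _ ≤ sSup (G '' s) + (((n + n₀ : ℕ) : ℝ) + 1)⁻¹ := by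
          gcongr; exact le_csSup hba (mem_image_of_mem _ hz)
      _ < sSup (G '' s) + ε := by linarith
  -- the no-strict-crossing clause forbids `min < r` together with `max > R`
  have hnot : ¬ (sInf (G '' s) < r ∧ R < sSup (G '' s)) := by
    rintro ⟨hlt, hgt⟩
    obtain ⟨zm, hzm, hzmin⟩ := hsc.exists_isMinOn hsne hGc.continuousOn
    obtain ⟨zM, hzM, hzmax⟩ := hsc.exists_isMaxOn hsne hGc.continuousOn
    have hm : G zm ≤ sInf (G '' s) :=
      le_csInf (hsne.image _) (by rintro _ ⟨z', hz', rfl⟩; exact hzmin hz')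
    have hM : sSup (G '' s) ≤ G zM :=
      csSup_le (hsne.image _) (by rintro _ ⟨z', hz', rfl⟩; exact hzmax hz')
    have hm' : G zm < r := by linarith
    have hM' : R < G zM := by linarith
    exact hneg ⟨c₀, hc₀L, ⟨zm, hc₀s ▸ hzm, hm'⟩, zM, hc₀s ▸ hzM, hM'⟩
  -- conclusion
  rw [mem_iUnion₂]
  refine ⟨s, ⟨c₀, hc₀L, hc₀s, ?_⟩, ?_⟩
  · obtain ⟨_, _, _, h⟩ := (hlarge n₀ le_rfl)
    have : s ∈ 𝒯 := by
      obtain ⟨n, hn⟩ := hA.nonempty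
      rw [← hAmem n hn]; exact hlarge _ (Nat.le_add_left _ _)
    obtain ⟨_, _, _, h'⟩ := this
    exact h'
  · rcases eq_or_lt_of_le hinf_le with h | h
    · exact Or.inl ⟨hθ, h⟩
    · rcases eq_or_lt_of_le hsup_ge with h' | h'
      · exact Or.inr ⟨hθ, h'.symm⟩
      · exact absurd ⟨h, h'⟩ hnot

/-! ### Hypothesis (b): the near-miss events are null in disc domains -/

/-- **No touching in the Camia–Newman limit** (hypothesis (b) of
`SmirnovWerner2001_twoArm_scalingLimit_of_loopLimit`, for disc domains). For a
Continuum-Nonsimple-Loop family `ν` (`IsCNLFamily`: conformally invariant laws with a.s. finitely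
many traces of diameter `> ε`), `0 < r < R` and `ρ ≥ 6R`, the near-miss event of the hexagonal
annulus `r ≤ N ≤ R` — every `ε`-near crossing exists but no member crosses strictly — is
`ν (disc ρ)`-null. Proof by Möbius averaging: the law is invariant under the automorphisms
`Φ_θ` of the disc, the event read through `Φ_θ` is the near-miss event of `N ∘ Φ_θ`, and for a.e.
collection the set of parameters `θ` at which it near-misses lies in finitely many Lebesgue-null level
sets (`setOf_nearMiss_param_subset`, `volume_levelSet_min_eq_zero`, `volume_levelSet_max_eq_zero`);
Tonelli (`measure_eq_zero_of_ae_le_sections`) concludes. [cite: CamiaNewman2006, Thm 7 and §6] -/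
theorem IsCNLFamily.measure_nearMiss_eq_zero {ν : JordanDomain → Measure (LoopSpace ℂ)} (hν : IsCNLFamily ν)
    {r R ρ : ℝ} (hr : 0 < r) (hrR : r < R) (hρR : 6 * R ≤ ρ) (hρ : 0 < ρ) :
    ν (JordanDomain.disc ρ hρ) {L : LoopSpace ℂ |
      (∀ ε > 0, ∃ c ∈ L, (∃ z ∈ CurveClass.range c, hexGauge z ≤ r + ε) ∧
        ∃ z ∈ CurveClass.range c, R - ε ≤ hexGauge z) ∧
      ¬ ∃ c ∈ L, (∃ z ∈ CurveClass.range c, hexGauge z < r) ∧ ∃ z ∈ CurveClass.range c, R < hexGauge z} = 0 := by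
  set D := JordanDomain.disc ρ hρ with hDdef
  haveI := hν.isProbabilityMeasure D
  -- pass to the Borel near-miss event `B`
  refine measure_mono_null (LoopSpace.nearMiss_subset_nearMiss hexGauge r R) ?_
  set B : Set (LoopSpace ℂ) := {L : LoopSpace ℂ |
      (∀ n : ℕ, ∃ c ∈ L, (∃ z ∈ CurveClass.range c, hexGauge z < r + ((n : ℝ) + 1)⁻¹) ∧
        ∃ z ∈ CurveClass.range c, R - ((n : ℝ) + 1)⁻¹ < hexGauge z) ∧
      ¬ ∃ c ∈ L, (∃ z ∈ CurveClass.range c, hexGauge z < r) ∧ ∃ z ∈ CurveClass.range c, R < hexGauge z} with hB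
  have hBm : MeasurableSet B := LoopSpace.measurableSet_nearMiss continuous_hexGauge r R
  -- the parametrised near-miss events of the distorted gauges
  set F : ℂ → ℂ → ℝ := fun θ z ↦ hexGauge (ballMoebiusExt ρ (shearSL θ) z) with hF
  have hFc : Continuous (Function.uncurry F) := continuous_hexGauge_ballMoebiusExt ρ
  set S : Set (ℂ × LoopSpace ℂ) := {x : ℂ × LoopSpace ℂ |
      (∀ n : ℕ, ∃ c ∈ x.2, (∃ z ∈ CurveClass.range c, F x.1 z < r + ((n : ℝ) + 1)⁻¹) ∧
        ∃ z ∈ CurveClass.range c, R - ((n : ℝ) + 1)⁻¹ < F x.1 z) ∧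
      ¬ ∃ c ∈ x.2, (∃ z ∈ CurveClass.range c, F x.1 z < r) ∧ ∃ z ∈ CurveClass.range c, R < F x.1 z} with hS
  have hSm : MeasurableSet S := LoopSpace.measurableSet_nearMiss_prod hFc r R
  -- the parameter measure
  set μ : Measure ℂ := (volume : Measure ℂ).restrict (ball 0 4⁻¹) with hμ
  have hμ0 : μ ≠ 0 := by
    rw [hμ, Ne, Measure.restrict_eq_zero]
    exact (measure_ball_pos volume (0 : ℂ) (by norm_num)).ne'
  refine measure_eq_zero_of_ae_le_sections (μ := μ) hμ0 hSm (Eventually.of_forall fun θ ↦ ?_) ?_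
  · -- invariance: `ν D B = ν D (Φ_θ⁻¹ B) ≤ ν D S_θ`
    rw [hν.measure_preimage_map_ballMoebiusExt hρ (shearSL θ) hBm]
    exact measure_mono (LoopSpace.map_preimage_nearMiss_subset (ballMoebiusExt ρ (shearSL θ)) continuous_hexGauge r R)
  · -- for a.e. collection, the parameters at which it near-misses form a null set
    obtain ⟨δ₁, hδ₁, hmod⟩ := exists_forall_dist_ballMoebiusExt_lt hρ (by linarith : (0 : ℝ) < (R - r) / 4)
    filter_upwards [hν.ae_finite_traces D] with L hL
    have hfin := hL (δ₁ / 2) (half_pos hδ₁)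
    rw [hμ, Measure.restrict_apply' measurableSet_ball]
    have hsub : (fun θ : ℂ ↦ (θ, L)) ⁻¹' S ∩ ball 0 4⁻¹ ⊆ {θ : ℂ | θ ∈ ball (0 : ℂ) 4⁻¹ ∧
        ((∀ n : ℕ, ∃ c ∈ L, (∃ z ∈ CurveClass.range c, F θ z < r + ((n : ℝ) + 1)⁻¹) ∧
          ∃ z ∈ CurveClass.range c, R - ((n : ℝ) + 1)⁻¹ < F θ z) ∧
        ¬ ∃ c ∈ L, (∃ z ∈ CurveClass.range c, F θ z < r) ∧ ∃ z ∈ CurveClass.range c, R < F θ z)} := by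
      rintro θ ⟨hθS, hθb⟩; exact ⟨hθb, hθS⟩
    refine measure_mono_null (hsub.trans (setOf_nearMiss_param_subset hrR hδ₁ hmod L hfin)) ?_
    refine (measure_biUnion_null_iff hfin.countable).2 fun s hs ↦ ?_
    obtain ⟨c₀, -, hc₀s, -⟩ := hs
    have hsc : IsCompact s := hc₀s ▸ CurveClass.isCompact_range c₀
    have hsne : s.Nonempty := hc₀s ▸ CurveClass.range_nonempty c₀
    exact measure_union_null (volume_levelSet_min_eq_zero hρ hr (by linarith) hsc hsne)
      (volume_levelSet_max_eq_zero hρ (hr.trans hrR) (by linarith) hsc hsne)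

/-! ### The named fact from the loop limit and the continuum exponent -/

/-- **`SmirnovWerner2001_twoArm_scalingLimit` from `exists_isCNLFamily_tendsto` and the continuum
exponent alone.** With the discs `D_n` of radius `6n + 6` as domains, the no-touching hypothesis of
`SmirnovWerner2001_twoArm_scalingLimit_of_cnl` is discharged by `IsCNLFamily.measure_nearMiss_eq_zero`,
so the named fact (Smirnov–Werner 2001, §4: (16) the existence of the two-arm scaling limit, and (9)
its exponent `-1/4`) follows from the Camia–Newman convergence of the loop collections and the exponent
`-1/4` of the continuum annulus-crossing probabilities `(ν D_n) Cross(1, n)` — the radial `SLE₆`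
computation (12), (13), (15) of the source (Lawler–Schramm–Werner, Acta Math. 187 (2001), Thm 3.1),
which remains the hypothesis `hexp`. [cite: SmirnovWernerMRL2001, §4 (9), (16)] -/
theorem SmirnovWerner2001_twoArm_scalingLimit_of_cnl_of_exponent (h : exists_isCNLFamily_tendsto)
    (hexp : ∀ ν : JordanDomain → Measure (LoopSpace ℂ), IsCNLFamily ν →
      (∀ D : JordanDomain, TendstoLaw (Ωδ := fun _ ↦ SiteConfig (Site 2))
        (fun δ ↦ triLoopCollection D δ) (fun _ ↦ triSitePercolation half) id (ν D)) →
      Tendsto (fun n : ℕ ↦ Real.log ((ν (JordanDomain.disc (6 * (n : ℝ) + 6) (by positivity))).real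
        (loopHexCrossing (1 : ℝ) (n : ℝ))) / Real.log n) atTop (𝓝 (-(1 / 4)))) :
    SmirnovWerner2001_twoArm_scalingLimit := by
  refine SmirnovWerner2001_twoArm_scalingLimit_of_cnl h (fun n ↦ JordanDomain.disc (6 * (n : ℝ) + 6) (by positivity))
    (fun n ↦ ?_) (fun ν hν _ r R hr hrR ↦ ?_) hexp
  · intro z hz
    rw [JordanDomain.carrier_disc, mem_ball_zero_iff]
    rw [mem_closedBall_zero_iff] at hz
    have : (0 : ℝ) ≤ n := Nat.cast_nonneg n
    linarith
  · have hr' : (0 : ℝ) < r := by exact_mod_cast hr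
    have hrR' : (r : ℝ) < R := by exact_mod_cast hrR
    exact hν.measure_nearMiss_eq_zero hr' hrR' (by linarith) _

end Literature.Probability.Percolation
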